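import Literature.Geometry.Lorentzian.KerrObstructionFirstOrder
import HarnessLib

/-!
# The outer-layer obstruction of Li–Mei's interior Kerr gluing is `L p + O(|p|²)`

Support file (all results proved; no named facts) for the named fact `LiMei.interiorKerrGluing`
(`InteriorKerrGluing.lean`; J. Li, H. Mei, *A construction of collapsing spacetimes in vacuum*,
Comm. Math. Phys. 378 (2020) = arXiv:2005.01249, Prop. 4.1), Step S5 of the architecture recorded
in `InteriorKerrGluingReduction.lean` (Li–Mei p. 25:
"`𝓘(m, a⃗) = (8π(m − m₀), −8π m₀ a⃗) + (ε₀, ε₁, ε₂, ε₃) + O(ε²)`", the `O(|p|²) ⊂ O(ε²)` part coming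
from the Kerr family).

The part of the linearised obstruction supported on the OUTER cut-off layer is
`∫ √g₀ (⟨γ_p, DM*_γ(χ X)⟩ + ⟨κ_p, DM*_κ(χ X)⟩) dy` with the EXACT variation
`(γ_p, κ_p) = (H[M + δm, ‖b‖, R_b] − G₀, K[M + δm, ‖b‖, R_b] − K₀)` of the Kerr cylinder family
(`p = (δm, b)`, `R_b = spinIsometry b`, `(G₀, K₀)` the Schwarzschild cylinder). By the paired
commutators of `SchwarzschildCylinderCommutators.lean` its integrand is, pointwise on `{1 < ‖y‖}`,
the functional `LiMei.timeIntegrandWith` (for `X = ∂_t`) resp. `LiMei.rotIntegrandWith` (for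
`X = Ω_ω = ω × ·`) of this file applied to `(γ_p(y), κ_p(y))`; both functionals are LINEAR in the
pair of bilinear forms and bounded by `|χ₀'(‖y‖)| × (sup over unit vectors)`
(`LiMei.abs_timeIntegrandWith_le`, `LiMei.abs_rotIntegrandWith_le`). On the first-order variation
`(firstOrderH, firstOrderK)` they integrate to `8π δm` and `−8πM⟨b, ω⟩`
(`KerrObstructionFirstOrder.lean`), and the family expansion
(`exists_abs_cylH_sub_sub_firstOrderH_le`, `exists_abs_cylK_sub_sub_firstOrderK_le`) bounds the
difference by `C(|δm| + ‖b‖)²` on the shell carrying `χ₀'`. Hence the main results: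

* `LiMei.exists_abs_integral_timeIntegrandWith_sub_le` — for `|δm| + ‖b‖ ≤ δ` the exact
  `∂_t`-integrand is integrable and **`|∫ (∂_t-integrand)(γ_p, κ_p) − 8π δm| ≤ C (|δm| + ‖b‖)²`**;
* `LiMei.exists_abs_integral_rotIntegrandWith_sub_le` — the same for `Ω_ω`, `‖ω‖ ≤ 1`:
  **`|∫ (Ω_ω-integrand)(γ_p, κ_p) + 8πM⟨b, ω⟩| ≤ C (|δm| + ‖b‖)²`**,

for every `C¹` radial profile `χ₀` equal to `1` on `|r| ≤ t` and to `0` on `s ≤ |r|` with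
`1 ≤ ρ₁ < t`, `s < ρ₂` (the outer profile `radialCutoff t s` qualifies), the constants depending on
`M, r₀, ρ₁, ρ₂, τ₀` and `χ₀` only.

## References

* J. Li, H. Mei, arXiv:2005.01249, §4, proof of Prop. 4.1, pp. 23–25 (key `LiMei2020`).
-/

noncomputable section

open Set Filter Function Metric MeasureTheory
open scoped Topology RealInnerProductSpace Real

namespace Literature.Geometry.Lorentzian

namespace LiMei

attribute [local instance] instNormedAddCommGroupBilinE3 instNormedSpaceBilinE3

/-! ### Bounds for the two evaluation functionals -/

/-- Bilinear scaling: `β(y, y) = ‖y‖² β(ŷ, ŷ)`. [folklore] -/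
theorem apply_self_eq_norm_sq_mul (β : E3 →L[ℝ] E3 →L[ℝ] ℝ) {y : E3} (hy : y ≠ 0) :
    β y y = ‖y‖ ^ 2 * β (‖y‖⁻¹ • y) (‖y‖⁻¹ • y) := by
  have hρ : ‖y‖ ≠ 0 := norm_ne_zero_iff.2 hy
  simp only [map_smul, smul_apply, smul_eq_mul]
  field_simp

/-- A bound on unit vectors forces `0 ≤ B`. [folklore] -/
theorem nonneg_of_unit_bound (β : E3 →L[ℝ] E3 →L[ℝ] ℝ) {B : ℝ}
    (hB : ∀ v w : E3, ‖v‖ ≤ 1 → ‖w‖ ≤ 1 → |β v w| ≤ B) : 0 ≤ B :=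
  (abs_nonneg _).trans (hB 0 0 (by simp) (by simp))

/-- **`|T(β)| ≤ 4 sup_{|v|,|w| ≤ 1} |β(v,w)|`** for the trace defect
`T(β) = Σᵢ β(eᵢ,eᵢ) − β(y,y)/‖y‖²` (`y ≠ 0`). [folklore] -/
theorem abs_traceDefect_le (β : E3 →L[ℝ] E3 →L[ℝ] ℝ) {B : ℝ}
    (hB : ∀ v w : E3, ‖v‖ ≤ 1 → ‖w‖ ≤ 1 → |β v w| ≤ B) {y : E3} (hy : y ≠ 0) :
    |∑ i, β (EuclideanSpace.single i 1) (EuclideanSpace.single i 1) - β y y / ‖y‖ ^ 2| ≤ 4 * B := by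
  have hρ : ‖y‖ ≠ 0 := norm_ne_zero_iff.2 hy
  have he : ∀ i : Fin 3, ‖(EuclideanSpace.single i (1 : ℝ) : E3)‖ ≤ 1 := fun i ↦ by
    rw [PiLp.norm_single, norm_one]
  have h1 : |∑ i, β (EuclideanSpace.single i 1) (EuclideanSpace.single i 1)| ≤ 3 * B := by
    refine (Finset.abs_sum_le_sum_abs _ _).trans ?_
    calc ∑ i, |β (EuclideanSpace.single i (1 : ℝ)) (EuclideanSpace.single i 1)|
        ≤ ∑ _i : Fin 3, B := Finset.sum_le_sum fun i _ ↦ hB _ _ (he i) (he i)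
      _ = 3 * B := by simp
  have h2 : |β y y / ‖y‖ ^ 2| ≤ B := by
    have : β y y / ‖y‖ ^ 2 = β (‖y‖⁻¹ • y) (‖y‖⁻¹ • y) := by
      rw [apply_self_eq_norm_sq_mul β hy]; field_simp
    rw [this]
    exact hB _ _ (norm_unitDir_le_one y) (norm_unitDir_le_one y)
  calc |∑ i, β (EuclideanSpace.single i 1) (EuclideanSpace.single i 1) - β y y / ‖y‖ ^ 2|
      ≤ |∑ i, β (EuclideanSpace.single i 1) (EuclideanSpace.single i 1)| + |β y y / ‖y‖ ^ 2| := by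
        rw [sub_eq_add_neg]
        exact (abs_add_le _ _).trans (by rw [abs_neg])
    _ ≤ 3 * B + B := add_le_add h1 h2
    _ = 4 * B := by ring

/-- **Lagrange's identity** `‖ω × y‖² = ‖ω‖²‖y‖² − ⟨ω, y⟩²`. [folklore] -/
theorem norm_crossVec_sq (ω y : E3) : ‖crossVec ω y‖ ^ 2 = ‖ω‖ ^ 2 * ‖y‖ ^ 2 - ⟪ω, y⟫ ^ 2 := by
  have hn : ∀ u : E3, ‖u‖ ^ 2 = u 0 ^ 2 + u 1 ^ 2 + u 2 ^ 2 := fun u ↦ by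
    rw [EuclideanSpace.real_norm_sq_eq, Fin.sum_univ_three]
  have hi : ⟪ω, y⟫ = ω 0 * y 0 + ω 1 * y 1 + ω 2 * y 2 := by
    rw [PiLp.inner_apply, Fin.sum_univ_three]; simp [mul_comm]
  rw [hn, hn, hn, hi, crossVec_apply_zero, crossVec_apply_one, crossVec_apply_two]
  ring

/-- `‖ω × y‖ ≤ ‖ω‖ ‖y‖`. [folklore] -/
theorem norm_crossVec_le (ω y : E3) : ‖crossVec ω y‖ ≤ ‖ω‖ * ‖y‖ := by
  have h2 : ‖crossVec ω y‖ ^ 2 ≤ (‖ω‖ * ‖y‖) ^ 2 := by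
    rw [norm_crossVec_sq, mul_pow]; nlinarith [sq_nonneg ⟪ω, y⟫]
  exact (sq_le_sq₀ (norm_nonneg _) (by positivity)).1 h2

/-- **`|β(ω × y, y)| ≤ ‖y‖² sup_{|v|,|w| ≤ 1} |β(v,w)|`** for `‖ω‖ ≤ 1`. [folklore] -/
theorem abs_apply_crossVec_self_le (β : E3 →L[ℝ] E3 →L[ℝ] ℝ) {B : ℝ}
    (hB : ∀ v w : E3, ‖v‖ ≤ 1 → ‖w‖ ≤ 1 → |β v w| ≤ B) {ω : E3} (hω : ‖ω‖ ≤ 1) (y : E3) :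
    |β (crossVec ω y) y| ≤ ‖y‖ ^ 2 * B := by
  rcases eq_or_ne y 0 with rfl | hy
  · simp
  have hρ : ‖y‖ ≠ 0 := norm_ne_zero_iff.2 hy
  have key : β (crossVec ω y) y = ‖y‖ ^ 2 * β (‖y‖⁻¹ • crossVec ω y) (‖y‖⁻¹ • y) := by
    simp only [map_smul, smul_apply, smul_eq_mul]; field_simp
  have hv : ‖‖y‖⁻¹ • crossVec ω y‖ ≤ 1 := by
    rw [norm_smul, norm_inv, norm_norm]
    calc ‖y‖⁻¹ * ‖crossVec ω y‖ ≤ ‖y‖⁻¹ * (‖ω‖ * ‖y‖) :=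
          mul_le_mul_of_nonneg_left (norm_crossVec_le ω y) (inv_nonneg.2 (norm_nonneg _))
      _ = ‖ω‖ := by field_simp
      _ ≤ 1 := hω
  rw [key, abs_mul, abs_of_nonneg (by positivity)]
  exact mul_le_mul_of_nonneg_left (hB _ _ hv (norm_unitDir_le_one y)) (by positivity)

/-! ### The two linearised obstruction integrands as functionals of the variation -/

/-- **The `∂_t`-integrand of the linearised obstruction** at the Schwarzschild cylinder
(`A = 2M/r₀ − 1`, `ρ = ‖y‖`), as a functional of the variation `(β_H, β_K)` at the point `y`:
`√A r₀²/ρ² · [χ₀'(ρ)((M − r₀)/(2r₀²√A))(ρ²/r₀²) T(β_H) + χ₀'(ρ)(ρ²/r₀²) T(β_K)]`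
(= `√g₀ (⟨β_H, DM*_γ(χ∂_t)⟩ + ⟨β_K, DM*_κ(χ∂_t)⟩)` by `pairAt_adjMomGS/KS_cutoff_dirVec` and
`sqrtDetGram_cylH_zero_spin`). [cite: LiMei2020, proof of Prop. 4.1, pp. 23–25] -/
def timeIntegrandWith (M r₀ : ℝ) (χ₀ : ℝ → ℝ) (βH βK : E3 →L[ℝ] E3 →L[ℝ] ℝ) (y : E3) : ℝ :=
  Real.sqrt (2 * M / r₀ - 1) * r₀ ^ 2 / ‖y‖ ^ 2 *
    (deriv χ₀ ‖y‖ * ((M - r₀) / (2 * r₀ ^ 2 * Real.sqrt (2 * M / r₀ - 1))) * (‖y‖ ^ 2 / r₀ ^ 2) *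
        (∑ i, βH (EuclideanSpace.single i 1) (EuclideanSpace.single i 1) - βH y y / ‖y‖ ^ 2) +
      deriv χ₀ ‖y‖ * (‖y‖ ^ 2 / r₀ ^ 2) *
        (∑ i, βK (EuclideanSpace.single i 1) (EuclideanSpace.single i 1) - βK y y / ‖y‖ ^ 2))

/-- **The `Ω_ω`-integrand of the linearised obstruction** at the Schwarzschild cylinder, as a
functional of the variation at `y`:
`√A r₀²/ρ² · [−(χ₀'(ρ)/(r₀√Aρ)) β_H(ω × y, y) − (χ₀'(ρ)/(ρA)) β_K(ω × y, y)]`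
(= `√g₀ (⟨β_H, DM*_γ(χΩ_ω)⟩ + ⟨β_K, DM*_κ(χΩ_ω)⟩)` by `pairAt_adjMomGS/KS_cutoff_skew`).
[cite: LiMei2020, proof of Prop. 4.1, pp. 23–25] -/
def rotIntegrandWith (M r₀ : ℝ) (χ₀ : ℝ → ℝ) (ω : E3) (βH βK : E3 →L[ℝ] E3 →L[ℝ] ℝ) (y : E3) : ℝ :=
  Real.sqrt (2 * M / r₀ - 1) * r₀ ^ 2 / ‖y‖ ^ 2 *
    (-(deriv χ₀ ‖y‖ / (r₀ * Real.sqrt (2 * M / r₀ - 1) * ‖y‖)) * βH (crossCLM ω y) y +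
      -(deriv χ₀ ‖y‖ / (‖y‖ * (2 * M / r₀ - 1))) * βK (crossCLM ω y) y)

/-- The `∂_t`-integrand is linear in the variation. [folklore] -/
theorem timeIntegrandWith_sub (M r₀ : ℝ) (χ₀ : ℝ → ℝ) (βH βK βH' βK' : E3 →L[ℝ] E3 →L[ℝ] ℝ)
    (y : E3) :
    timeIntegrandWith M r₀ χ₀ (βH - βH') (βK - βK') y =
      timeIntegrandWith M r₀ χ₀ βH βK y - timeIntegrandWith M r₀ χ₀ βH' βK' y := by
  simp only [timeIntegrandWith, sub_apply, Finset.sum_sub_distrib]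
  ring

/-- The `Ω_ω`-integrand is linear in the variation. [folklore] -/
theorem rotIntegrandWith_sub (M r₀ : ℝ) (χ₀ : ℝ → ℝ) (ω : E3) (βH βK βH' βK' : E3 →L[ℝ] E3 →L[ℝ] ℝ)
    (y : E3) :
    rotIntegrandWith M r₀ χ₀ ω (βH - βH') (βK - βK') y =
      rotIntegrandWith M r₀ χ₀ ω βH βK y - rotIntegrandWith M r₀ χ₀ ω βH' βK' y := by
  simp only [rotIntegrandWith, sub_apply]
  ring

/-- The `∂_t`-integrand vanishes where `χ₀'(‖y‖) = 0`. [folklore] -/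
theorem timeIntegrandWith_eq_zero (M r₀ : ℝ) {χ₀ : ℝ → ℝ} (βH βK : E3 →L[ℝ] E3 →L[ℝ] ℝ) {y : E3}
    (h : deriv χ₀ ‖y‖ = 0) : timeIntegrandWith M r₀ χ₀ βH βK y = 0 := by
  simp only [timeIntegrandWith, h, zero_mul, add_zero, mul_zero]

/-- The `Ω_ω`-integrand vanishes where `χ₀'(‖y‖) = 0`. [folklore] -/
theorem rotIntegrandWith_eq_zero (M r₀ : ℝ) {χ₀ : ℝ → ℝ} (ω : E3) (βH βK : E3 →L[ℝ] E3 →L[ℝ] ℝ)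
    {y : E3} (h : deriv χ₀ ‖y‖ = 0) : rotIntegrandWith M r₀ χ₀ ω βH βK y = 0 := by
  simp only [rotIntegrandWith, h, zero_div, neg_zero, zero_mul, add_zero, mul_zero]

/-- **Bound for the `∂_t`-integrand**:
`|timeIntegrandWith(β_H, β_K)(y)| ≤ √A |χ₀'(ρ)| (|(M − r₀)/(2r₀²√A)| · 4B_H + 4B_K)` when
`|β_H| ≤ B_H`, `|β_K| ≤ B_K` on unit vectors (`0 < r₀ < 2M`). [cite: LiMei2020, proof of Prop. 4.1, p. 25] -/
theorem abs_timeIntegrandWith_le {M r₀ : ℝ} (hr₀ : 0 < r₀) (h2M : r₀ < 2 * M) (χ₀ : ℝ → ℝ)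
    {βH βK : E3 →L[ℝ] E3 →L[ℝ] ℝ} {BH BK : ℝ}
    (hH : ∀ v w : E3, ‖v‖ ≤ 1 → ‖w‖ ≤ 1 → |βH v w| ≤ BH)
    (hK : ∀ v w : E3, ‖v‖ ≤ 1 → ‖w‖ ≤ 1 → |βK v w| ≤ BK) (y : E3) :
    |timeIntegrandWith M r₀ χ₀ βH βK y| ≤
      Real.sqrt (2 * M / r₀ - 1) * |deriv χ₀ ‖y‖| *
        (|(M - r₀) / (2 * r₀ ^ 2 * Real.sqrt (2 * M / r₀ - 1))| * (4 * BH) + 4 * BK) := by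
  have hBH := nonneg_of_unit_bound βH hH
  have hBK := nonneg_of_unit_bound βK hK
  rcases eq_or_ne y 0 with rfl | hy
  · simp only [timeIntegrandWith, norm_zero, ne_eq, OfNat.ofNat_ne_zero, not_false_eq_true, zero_pow,
      div_zero, zero_mul, abs_zero]
    positivity
  have hρ : ‖y‖ ≠ 0 := norm_ne_zero_iff.2 hy
  have hr : r₀ ≠ 0 := hr₀.ne'
  have hE1 := abs_traceDefect_le βH hH hy
  have hE2 := abs_traceDefect_le βK hK hy
  rw [timeIntegrandWith]
  set TH := ∑ i, βH (EuclideanSpace.single i 1) (EuclideanSpace.single i 1) - βH y y / ‖y‖ ^ 2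
  set TK := ∑ i, βK (EuclideanSpace.single i 1) (EuclideanSpace.single i 1) - βK y y / ‖y‖ ^ 2
  set s := Real.sqrt (2 * M / r₀ - 1) with hs_def
  have hs : s ≠ 0 := (Real.sqrt_pos.2 (lapse_pos hr₀ h2M)).ne'
  set c := (M - r₀) / (2 * r₀ ^ 2 * s) with hc_def
  have hform : s * r₀ ^ 2 / ‖y‖ ^ 2 *
      (deriv χ₀ ‖y‖ * c * (‖y‖ ^ 2 / r₀ ^ 2) * TH + deriv χ₀ ‖y‖ * (‖y‖ ^ 2 / r₀ ^ 2) * TK) =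
      s * deriv χ₀ ‖y‖ * (c * TH + TK) := by
    field_simp
  rw [hform, abs_mul, abs_mul, abs_of_nonneg (Real.sqrt_nonneg _)]
  refine mul_le_mul_of_nonneg_left ?_ (by positivity)
  calc |c * TH + TK| ≤ |c| * |TH| + |TK| := (abs_add_le _ _).trans (by rw [abs_mul])
    _ ≤ |c| * (4 * BH) + 4 * BK := add_le_add (mul_le_mul_of_nonneg_left hE1 (abs_nonneg _)) hE2

/-- **Bound for the `Ω_ω`-integrand** (`‖ω‖ ≤ 1`):
`|rotIntegrandWith(β_H, β_K)(y)| ≤ |χ₀'(ρ)| (r₀ B_H + r₀² B_K/√A)/ρ`. [cite: LiMei2020, proof of Prop. 4.1, p. 25] -/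
theorem abs_rotIntegrandWith_le {M r₀ : ℝ} (hr₀ : 0 < r₀) (h2M : r₀ < 2 * M) (χ₀ : ℝ → ℝ)
    {ω : E3} (hω : ‖ω‖ ≤ 1) {βH βK : E3 →L[ℝ] E3 →L[ℝ] ℝ} {BH BK : ℝ}
    (hH : ∀ v w : E3, ‖v‖ ≤ 1 → ‖w‖ ≤ 1 → |βH v w| ≤ BH)
    (hK : ∀ v w : E3, ‖v‖ ≤ 1 → ‖w‖ ≤ 1 → |βK v w| ≤ BK) (y : E3) :
    |rotIntegrandWith M r₀ χ₀ ω βH βK y| ≤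
      |deriv χ₀ ‖y‖| * (r₀ * BH + r₀ ^ 2 / Real.sqrt (2 * M / r₀ - 1) * BK) / ‖y‖ := by
  have hBH := nonneg_of_unit_bound βH hH
  have hBK := nonneg_of_unit_bound βK hK
  rcases eq_or_ne y 0 with rfl | hy
  · simp only [rotIntegrandWith, norm_zero, ne_eq, OfNat.ofNat_ne_zero, not_false_eq_true, zero_pow,
      div_zero, zero_mul, abs_zero]
    positivity
  have hρ : ‖y‖ ≠ 0 := norm_ne_zero_iff.2 hy
  have hρpos : 0 < ‖y‖ := norm_pos_iff.2 hy
  have hr : r₀ ≠ 0 := hr₀.ne'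
  have hA := lapse_pos hr₀ h2M
  have hE1 := abs_apply_crossVec_self_le βH hH hω y
  have hE2 := abs_apply_crossVec_self_le βK hK hω y
  rw [rotIntegrandWith, crossCLM_apply]
  set EH := βH (crossVec ω y) y
  set EK := βK (crossVec ω y) y
  set s := Real.sqrt (2 * M / r₀ - 1) with hs_def
  have hs : 0 < s := Real.sqrt_pos.2 hA
  have hs2 : 2 * M / r₀ - 1 = s ^ 2 := (Real.sq_sqrt hA.le).symm
  rw [hs2]
  have hform : s * r₀ ^ 2 / ‖y‖ ^ 2 *
      (-(deriv χ₀ ‖y‖ / (r₀ * s * ‖y‖)) * EH + -(deriv χ₀ ‖y‖ / (‖y‖ * s ^ 2)) * EK) =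
      -(deriv χ₀ ‖y‖ * ((r₀ * EH + r₀ ^ 2 / s * EK) / ‖y‖ ^ 3)) := by
    field_simp
    ring
  rw [hform, abs_neg, abs_mul, mul_div_assoc]
  refine mul_le_mul_of_nonneg_left ?_ (abs_nonneg _)
  rw [abs_div, abs_of_pos (pow_pos hρpos 3), div_le_div_iff₀ (pow_pos hρpos 3) hρpos]
  calc |r₀ * EH + r₀ ^ 2 / s * EK| * ‖y‖ ≤ (r₀ * |EH| + r₀ ^ 2 / s * |EK|) * ‖y‖ := by
        refine mul_le_mul_of_nonneg_right ((abs_add_le _ _).trans ?_) hρpos.le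
        rw [abs_mul, abs_mul, abs_of_pos hr₀, abs_of_pos (by positivity : 0 < r₀ ^ 2 / s)]
    _ ≤ (r₀ * (‖y‖ ^ 2 * BH) + r₀ ^ 2 / s * (‖y‖ ^ 2 * BK)) * ‖y‖ := by
        gcongr
    _ = (r₀ * BH + r₀ ^ 2 / s * BK) * ‖y‖ ^ 3 := by ring

/-! ### Support, continuity and measurability -/

/-- `χ₀'(‖y‖) ≠ 0` forces `t ≤ ‖y‖ ≤ s` for a profile equal to `1` on `|r| ≤ t` and to `0` on
`s ≤ |r|`. [folklore] -/
theorem norm_mem_Icc_of_deriv_ne_zero {χ₀ : ℝ → ℝ} {t s : ℝ} (h1 : ∀ r, |r| ≤ t → χ₀ r = 1)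
    (h0 : ∀ r, s ≤ |r| → χ₀ r = 0) {y : E3} (h : deriv χ₀ ‖y‖ ≠ 0) : t ≤ ‖y‖ ∧ ‖y‖ ≤ s := by
  refine ⟨le_of_not_gt fun hlt ↦ h ?_, le_of_not_gt fun hlt ↦ h ?_⟩
  · exact deriv_cutoffProfile_eq_zero_of_abs_lt h1 (by rwa [abs_norm])
  · exact deriv_cutoffProfile_eq_zero_of_lt_abs h0 (by rwa [abs_norm])

/-- `y ↦ |χ₀'(‖y‖)|` is integrable on `E3` (continuous with compact support). [folklore] -/
theorem integrable_abs_deriv_norm {χ₀ : ℝ → ℝ} {s : ℝ} (hχ : ContDiff ℝ 1 χ₀)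
    (h0 : ∀ r, s ≤ |r| → χ₀ r = 0) : Integrable (fun y : E3 ↦ |deriv χ₀ ‖y‖|) := by
  have hc : Continuous fun y : E3 ↦ |deriv χ₀ ‖y‖| :=
    ((hχ.continuous_deriv le_rfl).comp continuous_norm).abs
  refine hc.integrable_of_hasCompactSupport ?_
  refine HasCompactSupport.intro (K := closedBall (0 : E3) (|s| + 1)) (isCompact_closedBall _ _)
    fun y hy ↦ ?_
  rw [mem_closedBall, dist_zero_right, not_le] at hy
  rw [abs_eq_zero]
  exact deriv_cutoffProfile_eq_zero_of_lt_abs h0 (by rw [abs_norm]; linarith [le_abs_self s])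

/-- The metric field of the Kerr cylinder datum is continuous (`0 < r₀`). [folklore] -/
theorem continuous_cylH {r₀ : ℝ} (hr₀ : 0 < r₀) (m a τ₀ : ℝ) (R : E3 →ₗᵢ[ℝ] E3) :
    Continuous (cylH m a r₀ τ₀ R) :=
  continuous_iff_continuousAt.2 fun y ↦ (contDiffAt_cylH hr₀ τ₀ R y).continuousAt

/-- The second fundamental form field of the Kerr cylinder datum is continuous (admissible
parameters). [folklore] -/
theorem continuous_cylK [Kerr.Facts] {m a r₀ : ℝ} (ha : |a| < m) (h₁ : Kerr.rMinus m a < r₀)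
    (h₂ : r₀ < Kerr.rPlus m a) (τ₀ : ℝ) (R : E3 →ₗᵢ[ℝ] E3) :
    Continuous (cylK m a (pos_of_rMinus_lt ha h₁) τ₀ R) :=
  continuous_iff_continuousAt.2 fun y ↦ (contDiffAt_cylK ha h₁ h₂ τ₀ R y).continuousAt

/-- The exact `∂_t`-integrand is measurable for continuous variations and a `C¹` profile.
[folklore] -/
theorem measurable_timeIntegrandWith {M r₀ : ℝ} {χ₀ : ℝ → ℝ} (hχ : ContDiff ℝ 1 χ₀)
    {Γ Κ : E3 → E3 →L[ℝ] E3 →L[ℝ] ℝ} (hΓ : Continuous Γ) (hΚ : Continuous Κ) :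
    Measurable fun y ↦ timeIntegrandWith M r₀ χ₀ (Γ y) (Κ y) y := by
  have hd : Continuous fun y : E3 ↦ deriv χ₀ ‖y‖ := (hχ.continuous_deriv le_rfl).comp continuous_norm
  have hSΓ : Continuous fun y : E3 ↦
      ∑ i, Γ y (EuclideanSpace.single i 1) (EuclideanSpace.single i 1) :=
    continuous_finsetSum _ fun i _ ↦ (hΓ.clm_apply continuous_const).clm_apply continuous_const
  have hSΚ : Continuous fun y : E3 ↦
      ∑ i, Κ y (EuclideanSpace.single i 1) (EuclideanSpace.single i 1) :=
    continuous_finsetSum _ fun i _ ↦ (hΚ.clm_apply continuous_const).clm_apply continuous_const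
  have heΓ : Continuous fun y : E3 ↦ Γ y y y := (hΓ.clm_apply continuous_id).clm_apply continuous_id
  have heΚ : Continuous fun y : E3 ↦ Κ y y y := (hΚ.clm_apply continuous_id).clm_apply continuous_id
  unfold timeIntegrandWith
  exact ((measurable_const.mul (measurable_const.pow_const _)).div (measurable_norm.pow_const _)).mul
    ((((hd.measurable.mul measurable_const).mul
        ((measurable_norm.pow_const _).div measurable_const)).mul
        (hSΓ.measurable.sub (heΓ.measurable.div (measurable_norm.pow_const _)))).add
      ((hd.measurable.mul ((measurable_norm.pow_const _).div measurable_const)).mul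
        (hSΚ.measurable.sub (heΚ.measurable.div (measurable_norm.pow_const _)))))

/-- The exact `Ω_ω`-integrand is measurable for continuous variations and a `C¹` profile.
[folklore] -/
theorem measurable_rotIntegrandWith {M r₀ : ℝ} {χ₀ : ℝ → ℝ} (hχ : ContDiff ℝ 1 χ₀) (ω : E3)
    {Γ Κ : E3 → E3 →L[ℝ] E3 →L[ℝ] ℝ} (hΓ : Continuous Γ) (hΚ : Continuous Κ) :
    Measurable fun y ↦ rotIntegrandWith M r₀ χ₀ ω (Γ y) (Κ y) y := by
  have hd : Continuous fun y : E3 ↦ deriv χ₀ ‖y‖ := (hχ.continuous_deriv le_rfl).comp continuous_norm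
  have heΓ : Continuous fun y : E3 ↦ Γ y (crossCLM ω y) y :=
    (hΓ.clm_apply (crossCLM ω).continuous).clm_apply continuous_id
  have heΚ : Continuous fun y : E3 ↦ Κ y (crossCLM ω y) y :=
    (hΚ.clm_apply (crossCLM ω).continuous).clm_apply continuous_id
  unfold rotIntegrandWith
  exact ((measurable_const.mul (measurable_const.pow_const _)).div (measurable_norm.pow_const _)).mul
    (((hd.measurable.div ((measurable_const.mul measurable_const).mul measurable_norm)).neg.mul
        heΓ.measurable).add
      ((hd.measurable.div (measurable_norm.mul measurable_const)).neg.mul heΚ.measurable))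

/-! ### The outer-layer estimates -/

/-- **The exact `∂_t`-obstruction of the outer layer is `8π δm + O(|p|²)`.** For `0 < r₀ < 2M`,
`1 ≤ ρ₁ < t`, `s < ρ₂` and a `C¹` radial profile `χ₀` equal to `1` on `|r| ≤ t` and to `0` on
`s ≤ |r|`, there are `δ > 0` and `C ≥ 0` such that for `|δm| + ‖b‖ ≤ δ` the `∂_t`-integrand of the
linearised obstruction on the exact variation
`(H[M + δm, ‖b‖, R_b] − G₀, K[M + δm, ‖b‖, R_b] − K₀)` is integrable over `E3` and its integral
differs from `8π δm` by at most `C (|δm| + ‖b‖)²` (Li–Mei p. 25, first component of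
`𝓘 = (8π(m − m₀), …) + … + O(ε²)`). [cite: LiMei2020, proof of Prop. 4.1, p. 25] -/
theorem exists_abs_integral_timeIntegrandWith_sub_le [Kerr.Facts] {M r₀ : ℝ} (hr₀ : 0 < r₀)
    (h2M : r₀ < 2 * M) (τ₀ : ℝ) (R₀ : E3 →ₗᵢ[ℝ] E3) {ρ₁ ρ₂ t s : ℝ} (hρ₁ : 1 ≤ ρ₁) (hρt : ρ₁ < t)
    (hsρ : s < ρ₂) {χ₀ : ℝ → ℝ} (hχ : ContDiff ℝ 1 χ₀) (h1 : ∀ r, |r| ≤ t → χ₀ r = 1)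
    (h0 : ∀ r, s ≤ |r| → χ₀ r = 0) :
    ∃ δ C : ℝ, 0 < δ ∧ 0 ≤ C ∧ ∀ p : ℝ × E3, |p.1| + ‖p.2‖ ≤ δ →
      Integrable (fun y ↦ timeIntegrandWith M r₀ χ₀
          (cylH (M + p.1) ‖p.2‖ r₀ τ₀ (spinIsometry p.2) y - cylH M 0 r₀ τ₀ R₀ y)
          (cylK (M + p.1) ‖p.2‖ hr₀ τ₀ (spinIsometry p.2) y - cylK M 0 hr₀ τ₀ R₀ y) y) ∧
      |(∫ y, timeIntegrandWith M r₀ χ₀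
          (cylH (M + p.1) ‖p.2‖ r₀ τ₀ (spinIsometry p.2) y - cylH M 0 r₀ τ₀ R₀ y)
          (cylK (M + p.1) ‖p.2‖ hr₀ τ₀ (spinIsometry p.2) y - cylK M 0 hr₀ τ₀ R₀ y) y) -
        8 * π * p.1| ≤ C * (|p.1| + ‖p.2‖) ^ 2 := by
  obtain ⟨CH, hCH0, hCH⟩ := exists_abs_cylH_sub_sub_firstOrderH_le M hr₀ hρ₁ ρ₂ τ₀
  obtain ⟨δK, CK, hδK, hCK0, hCK⟩ := exists_abs_cylK_sub_sub_firstOrderK_le hr₀ h2M hρ₁ ρ₂ τ₀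
  obtain ⟨δB, hδB, hbox⟩ := kerrBox hr₀ h2M
  obtain ⟨ha0, h₁0, h₂0⟩ := admissible_zero_spin hr₀ h2M
  have ht0 : 0 ≤ t := by linarith
  obtain ⟨K₀, hK₀⟩ : ∃ K₀ : ℝ, K₀ = Real.sqrt (2 * M / r₀ - 1) *
      (|(M - r₀) / (2 * r₀ ^ 2 * Real.sqrt (2 * M / r₀ - 1))| * (4 * CH) + 4 * CK) := ⟨_, rfl⟩
  have hK₀0 : 0 ≤ K₀ := by rw [hK₀]; positivity
  obtain ⟨I, hI⟩ : ∃ I : ℝ, I = ∫ y : E3, |deriv χ₀ ‖y‖| := ⟨_, rfl⟩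
  have hI0 : 0 ≤ I := by rw [hI]; exact integral_nonneg fun y ↦ abs_nonneg _
  have hIint : Integrable (fun y : E3 ↦ |deriv χ₀ ‖y‖|) := integrable_abs_deriv_norm hχ h0
  refine ⟨min 1 (min δK δB), K₀ * I, by positivity, by positivity, fun p hp ↦ ?_⟩
  have hp1 : |p.1| + ‖p.2‖ ≤ 1 := hp.trans (min_le_left _ _)
  have hpK : |p.1| + ‖p.2‖ ≤ δK := hp.trans ((min_le_right _ _).trans (min_le_left _ _))
  have hpB : |M + p.1 - M| + |‖p.2‖| ≤ δB := by
    rw [add_sub_cancel_left, abs_norm]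
    exact hp.trans ((min_le_right _ _).trans (min_le_right _ _))
  obtain ⟨ha, h₁, h₂⟩ := hbox (M + p.1) ‖p.2‖ hpB
  -- names for the exact integrand `F` and the first-order integrand `F₀`
  obtain ⟨F, hF⟩ : ∃ F : E3 → ℝ, F = fun y ↦ timeIntegrandWith M r₀ χ₀
      (cylH (M + p.1) ‖p.2‖ r₀ τ₀ (spinIsometry p.2) y - cylH M 0 r₀ τ₀ R₀ y)
      (cylK (M + p.1) ‖p.2‖ hr₀ τ₀ (spinIsometry p.2) y - cylK M 0 hr₀ τ₀ R₀ y) y := ⟨_, rfl⟩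
  obtain ⟨F₀, hF₀⟩ : ∃ F₀ : E3 → ℝ, F₀ = fun y ↦ timeIntegrandWith M r₀ χ₀
      (firstOrderH M r₀ p y) (firstOrderK M r₀ p y) y := ⟨_, rfl⟩
  rw [← hF]
  -- the first-order integrand: closed form, integrability, value
  have hF₀eq : F₀ = fun y ↦ -(2 * p.1) * (deriv χ₀ ‖y‖ / ‖y‖ ^ 2) := by
    rw [hF₀]; exact funext fun y ↦ timeIntegrand_firstOrder_eq hr₀ h2M p χ₀ y
  have hF₀int : Integrable F₀ := by
    rw [hF₀eq]; exact (integrable_deriv_cutoffProfile_norm_div hχ h0).const_mul _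
  have hF₀val : ∫ y, F₀ y = 8 * π * p.1 := by
    rw [hF₀]; exact integral_timeIntegrand_firstOrder hr₀ h2M p hχ ht0 h1 h0
  -- the pointwise bound on `F − F₀`
  have hpt : ∀ y, |F y - F₀ y| ≤ K₀ * (|p.1| + ‖p.2‖) ^ 2 * |deriv χ₀ ‖y‖| := by
    intro y
    rw [hF, hF₀]
    dsimp only
    by_cases hd : deriv χ₀ ‖y‖ = 0
    · rw [timeIntegrandWith_eq_zero M r₀ _ _ hd, timeIntegrandWith_eq_zero M r₀ _ _ hd, sub_self,
        abs_zero, hd, abs_zero, mul_zero]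
    obtain ⟨hty, hys⟩ := norm_mem_Icc_of_deriv_ne_zero h1 h0 hd
    have hy1 : ρ₁ < ‖y‖ := lt_of_lt_of_le hρt hty
    have hy2 : ‖y‖ < ρ₂ := lt_of_le_of_lt hys hsρ
    have hy1' : 1 ≤ ‖y‖ := hρ₁.trans hy1.le
    have hy1'' : 1 < ‖y‖ := lt_of_lt_of_le (lt_of_le_of_lt hρ₁ hρt) hty
    have hbH : ∀ v w : E3, ‖v‖ ≤ 1 → ‖w‖ ≤ 1 →
        |(cylH (M + p.1) ‖p.2‖ r₀ τ₀ (spinIsometry p.2) y - cylH M 0 r₀ τ₀ R₀ y -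
          firstOrderH M r₀ p y) v w| ≤ CH * (|p.1| + ‖p.2‖) ^ 2 := by
      intro v w hv hw
      have h := hCH p hp1 v w hv hw y hy1 hy2
      rw [cylH_zero_spin_apply hr₀ τ₀ (spinIsometry p.2) hy1'] at h
      rw [sub_apply, sub_apply, sub_apply, sub_apply, cylH_zero_spin_apply hr₀ τ₀ R₀ hy1']
      exact h
    have hbK : ∀ v w : E3, ‖v‖ ≤ 1 → ‖w‖ ≤ 1 →
        |(cylK (M + p.1) ‖p.2‖ hr₀ τ₀ (spinIsometry p.2) y - cylK M 0 hr₀ τ₀ R₀ y -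
          firstOrderK M r₀ p y) v w| ≤ CK * (|p.1| + ‖p.2‖) ^ 2 := by
      intro v w hv hw
      have h := hCK p hpK v w hv hw y hy1 hy2
      rw [cylK_zero_spin_apply hr₀ h2M τ₀ (spinIsometry p.2) hy1''] at h
      rw [sub_apply, sub_apply, sub_apply, sub_apply, cylK_zero_spin_apply hr₀ h2M τ₀ R₀ hy1'']
      exact h
    have hb := abs_timeIntegrandWith_le hr₀ h2M χ₀ hbH hbK y
    rw [timeIntegrandWith_sub] at hb
    refine hb.trans (le_of_eq ?_)
    rw [hK₀]
    ring
  -- integrability of `F − F₀` and of `F`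
  have hΓc : Continuous fun y ↦
      cylH (M + p.1) ‖p.2‖ r₀ τ₀ (spinIsometry p.2) y - cylH M 0 r₀ τ₀ R₀ y :=
    (continuous_cylH hr₀ _ _ τ₀ _).sub (continuous_cylH hr₀ _ _ τ₀ _)
  have hΚc : Continuous fun y ↦
      cylK (M + p.1) ‖p.2‖ hr₀ τ₀ (spinIsometry p.2) y - cylK M 0 hr₀ τ₀ R₀ y :=
    (continuous_cylK ha h₁ h₂ τ₀ _).sub (continuous_cylK ha0 h₁0 h₂0 τ₀ R₀)
  have hmeasF : Measurable F := by
    rw [hF]; exact measurable_timeIntegrandWith hχ hΓc hΚc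
  have hmeasF₀ : Measurable F₀ := by
    rw [hF₀eq]
    exact ((((hχ.continuous_deriv le_rfl).measurable.comp measurable_norm).div
      (measurable_norm.pow_const _)).const_mul _)
  have hΔint : Integrable (fun y ↦ F y - F₀ y) :=
    Integrable.mono' (hIint.const_mul (K₀ * (|p.1| + ‖p.2‖) ^ 2))
      (hmeasF.sub hmeasF₀).aestronglyMeasurable
      (ae_of_all _ fun y ↦ by rw [Real.norm_eq_abs]; exact hpt y)
  have hFint : Integrable F := by
    refine (hΔint.add hF₀int).congr (ae_of_all _ fun y ↦ ?_)
    simp only [Pi.add_apply, sub_add_cancel]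
  refine ⟨hFint, ?_⟩
  -- the integral estimate
  rw [show (∫ y, F y) - 8 * π * p.1 = ∫ y, (F y - F₀ y) by
    rw [integral_sub hFint hF₀int, hF₀val]]
  have hle := norm_integral_le_of_norm_le (hIint.const_mul (K₀ * (|p.1| + ‖p.2‖) ^ 2))
    (ae_of_all _ fun y ↦ (by rw [Real.norm_eq_abs]; exact hpt y :
      ‖F y - F₀ y‖ ≤ K₀ * (|p.1| + ‖p.2‖) ^ 2 * |deriv χ₀ ‖y‖|))
  rw [Real.norm_eq_abs, integral_const_mul, ← hI] at hle
  calc |∫ y, (F y - F₀ y)| ≤ K₀ * (|p.1| + ‖p.2‖) ^ 2 * I := hle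
    _ = K₀ * I * (|p.1| + ‖p.2‖) ^ 2 := by ring

/-- **The exact `Ω_ω`-obstruction of the outer layer is `−8πM⟨b, ω⟩ + O(|p|²)`** (`‖ω‖ ≤ 1`),
under the same hypotheses (Li–Mei p. 25, rotational components `−8π m₀ a⃗` of `𝓘`).
[cite: LiMei2020, proof of Prop. 4.1, p. 25] -/
theorem exists_abs_integral_rotIntegrandWith_sub_le [Kerr.Facts] {M r₀ : ℝ} (hr₀ : 0 < r₀)
    (h2M : r₀ < 2 * M) (τ₀ : ℝ) (R₀ : E3 →ₗᵢ[ℝ] E3) {ρ₁ ρ₂ t s : ℝ} (hρ₁ : 1 ≤ ρ₁) (hρt : ρ₁ < t)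
    (hsρ : s < ρ₂) {χ₀ : ℝ → ℝ} (hχ : ContDiff ℝ 1 χ₀) (h1 : ∀ r, |r| ≤ t → χ₀ r = 1)
    (h0 : ∀ r, s ≤ |r| → χ₀ r = 0) :
    ∃ δ C : ℝ, 0 < δ ∧ 0 ≤ C ∧ ∀ p : ℝ × E3, |p.1| + ‖p.2‖ ≤ δ → ∀ ω : E3, ‖ω‖ ≤ 1 →
      Integrable (fun y ↦ rotIntegrandWith M r₀ χ₀ ω
          (cylH (M + p.1) ‖p.2‖ r₀ τ₀ (spinIsometry p.2) y - cylH M 0 r₀ τ₀ R₀ y)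
          (cylK (M + p.1) ‖p.2‖ hr₀ τ₀ (spinIsometry p.2) y - cylK M 0 hr₀ τ₀ R₀ y) y) ∧
      |(∫ y, rotIntegrandWith M r₀ χ₀ ω
          (cylH (M + p.1) ‖p.2‖ r₀ τ₀ (spinIsometry p.2) y - cylH M 0 r₀ τ₀ R₀ y)
          (cylK (M + p.1) ‖p.2‖ hr₀ τ₀ (spinIsometry p.2) y - cylK M 0 hr₀ τ₀ R₀ y) y) +
        8 * π * M * ⟪p.2, ω⟫| ≤ C * (|p.1| + ‖p.2‖) ^ 2 := by
  obtain ⟨CH, hCH0, hCH⟩ := exists_abs_cylH_sub_sub_firstOrderH_le M hr₀ hρ₁ ρ₂ τ₀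
  obtain ⟨δK, CK, hδK, hCK0, hCK⟩ := exists_abs_cylK_sub_sub_firstOrderK_le hr₀ h2M hρ₁ ρ₂ τ₀
  obtain ⟨δB, hδB, hbox⟩ := kerrBox hr₀ h2M
  obtain ⟨ha0, h₁0, h₂0⟩ := admissible_zero_spin hr₀ h2M
  have ht0 : 0 ≤ t := by linarith
  have hA := lapse_pos hr₀ h2M
  have hsA : 0 < Real.sqrt (2 * M / r₀ - 1) := Real.sqrt_pos.2 hA
  obtain ⟨K₁, hK₁⟩ : ∃ K₁ : ℝ, K₁ = r₀ * CH + r₀ ^ 2 / Real.sqrt (2 * M / r₀ - 1) * CK := ⟨_, rfl⟩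
  have hK₁0 : 0 ≤ K₁ := by rw [hK₁]; positivity
  obtain ⟨I, hI⟩ : ∃ I : ℝ, I = ∫ y : E3, |deriv χ₀ ‖y‖| := ⟨_, rfl⟩
  have hI0 : 0 ≤ I := by rw [hI]; exact integral_nonneg fun y ↦ abs_nonneg _
  have hIint : Integrable (fun y : E3 ↦ |deriv χ₀ ‖y‖|) := integrable_abs_deriv_norm hχ h0
  refine ⟨min 1 (min δK δB), K₁ * I, by positivity, by positivity, fun p hp ω hω ↦ ?_⟩
  have hp1 : |p.1| + ‖p.2‖ ≤ 1 := hp.trans (min_le_left _ _)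
  have hpK : |p.1| + ‖p.2‖ ≤ δK := hp.trans ((min_le_right _ _).trans (min_le_left _ _))
  have hpB : |M + p.1 - M| + |‖p.2‖| ≤ δB := by
    rw [add_sub_cancel_left, abs_norm]
    exact hp.trans ((min_le_right _ _).trans (min_le_right _ _))
  obtain ⟨ha, h₁, h₂⟩ := hbox (M + p.1) ‖p.2‖ hpB
  obtain ⟨F, hF⟩ : ∃ F : E3 → ℝ, F = fun y ↦ rotIntegrandWith M r₀ χ₀ ω
      (cylH (M + p.1) ‖p.2‖ r₀ τ₀ (spinIsometry p.2) y - cylH M 0 r₀ τ₀ R₀ y)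
      (cylK (M + p.1) ‖p.2‖ hr₀ τ₀ (spinIsometry p.2) y - cylK M 0 hr₀ τ₀ R₀ y) y := ⟨_, rfl⟩
  obtain ⟨F₀, hF₀⟩ : ∃ F₀ : E3 → ℝ, F₀ = fun y ↦ rotIntegrandWith M r₀ χ₀ ω
      (firstOrderH M r₀ p y) (firstOrderK M r₀ p y) y := ⟨_, rfl⟩
  rw [← hF]
  -- the first-order integrand: closed form, integrability, value
  have hk := integrable_deriv_cutoffProfile_norm_div (χ₀ := χ₀) hχ h0
  have hF₀eq : F₀ = fun y ↦ 3 * M * (deriv χ₀ ‖y‖ / ‖y‖ ^ 2) * ⟪p.2, ω⟫ -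
      3 * M * (deriv χ₀ ‖y‖ / ‖y‖ ^ 2 * (⟪p.2, ‖y‖⁻¹ • y⟫ * ⟪‖y‖⁻¹ • y, ω⟫)) := by
    rw [hF₀]; exact funext fun y ↦ rotIntegrand_firstOrder_eq hr₀ h2M p χ₀ ω y
  have hF₀int : Integrable F₀ := by
    rw [hF₀eq]
    exact ((hk.const_mul _).mul_const _).sub
      ((hk.mul_bdd (measurable_inner_unitDir_mul p.2 ω).aestronglyMeasurable
        (ae_of_all _ (abs_inner_unitDir_mul_le p.2 ω))).const_mul _)
  have hF₀val : ∫ y, F₀ y = -(8 * π * M) * ⟪p.2, ω⟫ := by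
    rw [hF₀]; exact integral_rotIntegrand_firstOrder hr₀ h2M p hχ ht0 h1 h0 ω
  -- the pointwise bound on `F − F₀`
  have hpt : ∀ y, |F y - F₀ y| ≤ K₁ * (|p.1| + ‖p.2‖) ^ 2 * |deriv χ₀ ‖y‖| := by
    intro y
    rw [hF, hF₀]
    dsimp only
    by_cases hd : deriv χ₀ ‖y‖ = 0
    · rw [rotIntegrandWith_eq_zero M r₀ ω _ _ hd, rotIntegrandWith_eq_zero M r₀ ω _ _ hd, sub_self,
        abs_zero, hd, abs_zero, mul_zero]
    obtain ⟨hty, hys⟩ := norm_mem_Icc_of_deriv_ne_zero h1 h0 hd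
    have hy1 : ρ₁ < ‖y‖ := lt_of_lt_of_le hρt hty
    have hy2 : ‖y‖ < ρ₂ := lt_of_le_of_lt hys hsρ
    have hy1' : 1 ≤ ‖y‖ := hρ₁.trans hy1.le
    have hy1'' : 1 < ‖y‖ := lt_of_lt_of_le (lt_of_le_of_lt hρ₁ hρt) hty
    have hbH : ∀ v w : E3, ‖v‖ ≤ 1 → ‖w‖ ≤ 1 →
        |(cylH (M + p.1) ‖p.2‖ r₀ τ₀ (spinIsometry p.2) y - cylH M 0 r₀ τ₀ R₀ y -
          firstOrderH M r₀ p y) v w| ≤ CH * (|p.1| + ‖p.2‖) ^ 2 := by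
      intro v w hv hw
      have h := hCH p hp1 v w hv hw y hy1 hy2
      rw [cylH_zero_spin_apply hr₀ τ₀ (spinIsometry p.2) hy1'] at h
      rw [sub_apply, sub_apply, sub_apply, sub_apply, cylH_zero_spin_apply hr₀ τ₀ R₀ hy1']
      exact h
    have hbK : ∀ v w : E3, ‖v‖ ≤ 1 → ‖w‖ ≤ 1 →
        |(cylK (M + p.1) ‖p.2‖ hr₀ τ₀ (spinIsometry p.2) y - cylK M 0 hr₀ τ₀ R₀ y -
          firstOrderK M r₀ p y) v w| ≤ CK * (|p.1| + ‖p.2‖) ^ 2 := by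
      intro v w hv hw
      have h := hCK p hpK v w hv hw y hy1 hy2
      rw [cylK_zero_spin_apply hr₀ h2M τ₀ (spinIsometry p.2) hy1''] at h
      rw [sub_apply, sub_apply, sub_apply, sub_apply, cylK_zero_spin_apply hr₀ h2M τ₀ R₀ hy1'']
      exact h
    have hb := abs_rotIntegrandWith_le hr₀ h2M χ₀ hω hbH hbK y
    rw [rotIntegrandWith_sub] at hb
    refine hb.trans ?_
    have hnum : 0 ≤ |deriv χ₀ ‖y‖| * (r₀ * (CH * (|p.1| + ‖p.2‖) ^ 2) +
        r₀ ^ 2 / Real.sqrt (2 * M / r₀ - 1) * (CK * (|p.1| + ‖p.2‖) ^ 2)) := by positivity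
    calc |deriv χ₀ ‖y‖| * (r₀ * (CH * (|p.1| + ‖p.2‖) ^ 2) +
          r₀ ^ 2 / Real.sqrt (2 * M / r₀ - 1) * (CK * (|p.1| + ‖p.2‖) ^ 2)) / ‖y‖
        ≤ |deriv χ₀ ‖y‖| * (r₀ * (CH * (|p.1| + ‖p.2‖) ^ 2) +
          r₀ ^ 2 / Real.sqrt (2 * M / r₀ - 1) * (CK * (|p.1| + ‖p.2‖) ^ 2)) :=
          div_le_self hnum hy1'
      _ = K₁ * (|p.1| + ‖p.2‖) ^ 2 * |deriv χ₀ ‖y‖| := by rw [hK₁]; ring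
  -- integrability of `F − F₀` and of `F`
  have hΓc : Continuous fun y ↦
      cylH (M + p.1) ‖p.2‖ r₀ τ₀ (spinIsometry p.2) y - cylH M 0 r₀ τ₀ R₀ y :=
    (continuous_cylH hr₀ _ _ τ₀ _).sub (continuous_cylH hr₀ _ _ τ₀ _)
  have hΚc : Continuous fun y ↦
      cylK (M + p.1) ‖p.2‖ hr₀ τ₀ (spinIsometry p.2) y - cylK M 0 hr₀ τ₀ R₀ y :=
    (continuous_cylK ha h₁ h₂ τ₀ _).sub (continuous_cylK ha0 h₁0 h₂0 τ₀ R₀)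
  have hmeasF : Measurable F := by
    rw [hF]; exact measurable_rotIntegrandWith hχ ω hΓc hΚc
  have hΔint : Integrable (fun y ↦ F y - F₀ y) :=
    Integrable.mono' (hIint.const_mul (K₁ * (|p.1| + ‖p.2‖) ^ 2))
      (hmeasF.aestronglyMeasurable.sub hF₀int.aestronglyMeasurable)
      (ae_of_all _ fun y ↦ by rw [Real.norm_eq_abs]; exact hpt y)
  have hFint : Integrable F := by
    refine (hΔint.add hF₀int).congr (ae_of_all _ fun y ↦ ?_)
    simp only [Pi.add_apply, sub_add_cancel]
  refine ⟨hFint, ?_⟩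
  rw [show (∫ y, F y) + 8 * π * M * ⟪p.2, ω⟫ = ∫ y, (F y - F₀ y) by
    rw [integral_sub hFint hF₀int, hF₀val]; ring]
  have hle := norm_integral_le_of_norm_le (hIint.const_mul (K₁ * (|p.1| + ‖p.2‖) ^ 2))
    (ae_of_all _ fun y ↦ (by rw [Real.norm_eq_abs]; exact hpt y :
      ‖F y - F₀ y‖ ≤ K₁ * (|p.1| + ‖p.2‖) ^ 2 * |deriv χ₀ ‖y‖|))
  rw [Real.norm_eq_abs, integral_const_mul, ← hI] at hle
  calc |∫ y, (F y - F₀ y)| ≤ K₁ * (|p.1| + ‖p.2‖) ^ 2 * I := hle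
    _ = K₁ * I * (|p.1| + ‖p.2‖) ^ 2 := by ring

end LiMei

end Literature.Geometry.Lorentzian

end
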